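import Literature.MathematicalPhysics.QuantumFieldTheory.Balaban1983to89.BlockAveragingZd
import Literature.MathematicalPhysics.QuantumFieldTheory.Balaban1983to89.B7Eq106Concrete

/-!
# `Balaban1983to89.B7SectCDGaugeAveragesRec` — [Balaban1985Averaging] Sect. C–D (59)–(109) pp. 27–33 FOR THE RECORD's AVERAGING STRUCTURE
# ([Balaban1987RG1] (0.3)–(0.4): centred blocks, symmetric loop family): the gauge-function averages (78)–(80), the block axial gauge
# (64)–(67), the «tilde» averages (65)∕(69), the block frames (62)∕(82)∕(85), the double-bar averages (89)–(91), the accumulated frames (97),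
# the level functions (76)∕(87) and the telescoped transporters (77)∕(101)–(108) — DEFINITION TWINS, on the `ℤᵈ` carriers, of the engine's
# `B7Eq84Concrete` ∕ `B7Eq92Concrete` ∕ `B7Eq99Concrete` ∕ `B7Eq106Concrete` objects under the TOKEN RULE of the «N05-REC» road

statement-level skeleton of published theorems with citation tags; proofs where landed; nothing here is a claim about the Yang–Mills mass gap

CITATION HEADER (lean-in-tree rule).  Cell `pub-ymgap`, seat `pub-ymgap-dag-n05-e` g35 (LEAD PEN of the «N05-REC» cell, director-ym №254∕№255, plan g90 SIZING
WORD 2026-08-29); module R0b-1 of the road's definitions stage (R0a = `BlockAveragingZd`, p690042).  `--kind definition --supports stmt-QuantumFields-20541`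
(K0⁷; count-neutral).  Sources READ: [3] = [Balaban1985Averaging] pp. 27–33 (`paper:balaban1985-cmp98-averaging`, journal page = PDF page + 16) through the
engine modules named below (this lineage's daily objects); [I] = [Balaban1987RG1] (0.3)–(0.4) pp. 252–253 (`paper:balaban1987-cmp109-rg-i-small-field` p0004–p0005).
TOKEN RULE (LEAD brief `HOME/pub-ymgap-dag-n05-e/N05-REC-LEAD.md` §2): (T1) `bavg ↦ bavgZ`, `avgIter ↦ avgIterZ` (the symmetric (0.4) average); (T2) ANCHORING —
blocks based at `L·z` in both structures, block points `L·z + boxVec L r ↦ L·z + offZ L r`, hence the coarse-site ∕ remainder maps `fl ↦ flZ`, `brem ↦ bremZ`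
(§0: `flZ L x = fl L (x + (L−1)∕2·𝟙)`, `x = L·flZ x + offZ (bremZ x)`); (T3) the axial ∕ frame words stay the SINGLE staircase `treeWord` (located: the record's
`radialContourData` ∕ `axialGaugeAt` are the engine's (1.7) staircase re-rooted at the centre), now from the centre to the centred block points
`treeWord (offZ L r)`.  Every definition below is the engine definition with exactly these substitutions (generated by substitution from the engine
text, then checked); declaration names carry the suffix `Z`; structure-free helpers (`tHol`, `Rc`, `mgauge`, `R0fun`, `hol`, `treeWord`, `expUnit`,
`mlog`) are REUSED BY NAME.
WHAT IS DEFINED (bodies; engine twin in brackets): §0 `ctrVec`, `flZ`, `bremZ`, `bctrZ` + `flZ_decomp`, `flZ_block`, `bremZ_block`, `flZ_smul`, `bremZ_smul`;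
§1 (78) `SexpZ`, `savgZ`, `R0avgZ` [`B7Eq99Concrete.Sexp∕savg∕R0avg`]; §2 (65)∕(69) `tildZ`, `tildIterZ`, (62)∕(82) `FcovZ`, `wframeZ`, (89)–(91) `dbavgCovZ`,
`dbavgCovIterZ`, (97) `vcovZ` [`B7Eq92Concrete`]; §3 (85) `wrecZ` [`B7Eq99Concrete.wrec`]; §4 (79)–(80) `uavgZ`, (64)–(67) `AxialGaugeZ`, (76)∕(87) `glevZ`, (77)
`telHolZ`, `telTwZ` [`B7Eq84Concrete`]; §5 (101)–(108) `lvHolZ`, `lvTwZ`, `lvDbTZ`, `lvFrZ`, `telUpZ`, `telProdZ` [`B7Eq106Concrete`]; §6 the recursion equations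
(`rfl`) and the values at the unit configuration where immediate.  NOT twinned here (later modules): the linearisations (110)–(127) (R0b-2), [6]'s classes (R0c).
GUARDS: all objects here are UNGUARDED (the engine-analysis editions, LEAD brief (T1)∕(T4)); the record's guarded (81) average `Node00.ShearedAveragingFlat.gaugeAvgIter
(loopAvgBlockOp expMeanLogSU)` is bridged to `uavgZ` at flat background in the road's item R7, on the small-field domain.
HONEST SCOPE.  Definitions + `rfl` bookkeeping; NO inequality of [3]∕[6]∕[I]; `HThm4Rec` UNDISCHARGED (nothing here discharges anything); N05 ∕ N07 NOT
discharged; counts unmoved (typed 28∕28 · discharged 7∕28); one finite 𝕋⁴ programme at fixed ε — nothing continuum ∕ ℝ⁴ ∕ OS ∕ mass gap ∕ Clay.  No `instance`,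
no `notation`, no `sorry`.
-/

set_option autoImplicit false

noncomputable section

open scoped BigOperators

namespace Literature.MathematicalPhysics.QuantumFieldTheory.Balaban1983to89.B7SectCDGaugeAveragesRec

open B7Prop1Explicit (Letter e hol treeWord boxVec expUnit seg)
open B7Prop1Explicit renaming Site → SiteZ
open B7Prop2Explicit (rescale rescale_apply)
open B7Eq92Concrete (Rc tHol mgauge)
open B7Eq99Concrete (R0fun)
open B7Eq84Concrete (brem bzero fl_decomp brem_block)
open B8Ineq130 (fl)
open B8Eq115GaugeFixing (fl_smul fl_block)
open MatrixLog (mlog)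
open BlockAveragingZd (offZ offZ_eq_boxVec_sub bavgZ avgIterZ IdxZ)

variable {d : ℕ}

/-! ## §0 Centred blocks: the coarse site below a fine site and its centred remainder -/

/-- The constant vector `(L−1)∕2·𝟙` — the offset of a block's centre from its lowest corner ([I] (0.3): blocks «with a center at y»).
[cite: Balaban1987RG1, (0.3) p.252] -/
def ctrVec (L : ℕ) : SiteZ d := fun _ => (((L - 1) / 2 : ℕ) : ℤ)

/-- `offZ = boxVec − ctrVec` (R0a's anchoring identity, re-spelt). [cite: Balaban1987RG1, (0.3) p.252] -/
theorem offZ_eq (L : ℕ) (r : Fin d → Fin L) : offZ L r = boxVec L r - ctrVec L := offZ_eq_boxVec_sub L r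

/-- **The coarse site `z` whose CENTRED block contains `x`**: `flZ L x := fl L (x + (L−1)∕2·𝟙)` (the engine's `fl` = «the coarse site below x» for
CORNER blocks, [3] (2) p. 17; the record's blocks are centred, [I] (0.3)). [cite: Balaban1987RG1, (0.3) p.252; Balaban1985Averaging, (2) p.17] -/
def flZ (L : ℕ) (x : SiteZ d) : SiteZ d := fl L (x + ctrVec L)

/-- **The centred remainder**: `bremZ L x ∈ {0,…,L−1}ᵈ` with `x = L·flZ x + offZ (bremZ x)` (the engine's `brem` shifted by the centre offset).
[cite: Balaban1987RG1, (0.3) p.252] -/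
def bremZ (L : ℕ) (hL : 1 ≤ L) (x : SiteZ d) : Fin d → Fin L := brem L hL (x + ctrVec L)

/-- The index of the block CENTRE in `{0,…,L−1}ᵈ`: `(L−1)∕2` in every coordinate (`offZ L (bctrZ hL) = 0`). [cite: Balaban1987RG1, (0.3) p.252] -/
def bctrZ {L : ℕ} (hL : 1 ≤ L) : Fin d → Fin L := fun _ => ⟨(L - 1) / 2, by omega⟩

/-- `offZ L (bctrZ hL) = 0`: the centre has offset zero. [cite: Balaban1987RG1, (0.3) p.252] -/
theorem offZ_bctrZ {L : ℕ} (hL : 1 ≤ L) : offZ L (bctrZ (d := d) hL) = 0 := by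
  funext ν
  simp [offZ, bctrZ]

/-- **Every site lies in exactly one centred block**: `L·flZ x + offZ (bremZ x) = x` (the engine's `fl_decomp` shifted). [cite: Balaban1987RG1, (0.3) p.252] -/
theorem flZ_decomp {L : ℕ} (hL : 1 ≤ L) (x : SiteZ d) : (L : ℤ) • flZ L x + offZ L (bremZ L hL x) = x := by
  have h := fl_decomp hL (x + ctrVec L)
  rw [offZ_eq]
  unfold flZ bremZ
  have h' : (L : ℤ) • fl L (x + ctrVec L) + boxVec L (brem L hL (x + ctrVec L)) - ctrVec L = x := by rw [h]; abel
  rw [← add_sub_assoc]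
  exact h'

/-- `flZ (L·z + offZ r) = z`. [cite: Balaban1987RG1, (0.3) p.252] -/
theorem flZ_block {L : ℕ} (hL : 1 ≤ L) (z : SiteZ d) (r : Fin d → Fin L) : flZ L ((L : ℤ) • z + offZ L r) = z := by
  unfold flZ
  rw [offZ_eq, add_assoc, sub_add_cancel]
  exact fl_block hL z r

/-- `bremZ (L·z + offZ r) = r`. [cite: Balaban1987RG1, (0.3) p.252] -/
theorem bremZ_block {L : ℕ} (hL : 1 ≤ L) (z : SiteZ d) (r : Fin d → Fin L) : bremZ L hL ((L : ℤ) • z + offZ L r) = r := by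
  unfold bremZ
  rw [offZ_eq, add_assoc, sub_add_cancel]
  exact brem_block hL z r

/-- `flZ (L·z) = z` (the centre lies in its own block). [cite: Balaban1987RG1, (0.3) p.252] -/
theorem flZ_smul {L : ℕ} (hL : 1 ≤ L) (z : SiteZ d) : flZ L ((L : ℤ) • z) = z := by
  simpa [offZ_bctrZ hL] using flZ_block hL z (bctrZ hL)

/-- `bremZ (L·z) = bctrZ` (the centre's index). [cite: Balaban1987RG1, (0.3) p.252] -/
theorem bremZ_smul {L : ℕ} (hL : 1 ≤ L) (z : SiteZ d) : bremZ L hL ((L : ℤ) • z) = bctrZ hL := by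
  simpa [offZ_bctrZ hL] using bremZ_block hL z (bctrZ hL)

/-! ## §1–§5 The definition twins (engine text under the TOKEN RULE) -/

section Twins

variable {𝔸 : Type*} [NormedRing 𝔸] [NormedAlgebra ℂ 𝔸] [CompleteSpace 𝔸]

-- twin of `B7Eq99Concrete.Sexp`
/-- (RECORD TWIN: centred blocks, offsets `offZ`, the symmetric (0.4) average `bavgZ`∕`avgIterZ` of `BlockAveragingZd`.) **The exponent of the site average (78)**: `S_g(y) := Σ_{x∈B(y)} L^{−d} log g(y)⁻¹g(x)` (`x = y + r`, `r ∈ [0,L)^d`;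
`log` = the series (21); print's `i·(1/i) = 1`). Print (78) p. 30: "(R̄₀v)(y) = (\overline{R(V₀)v})(y) = {(R(V₀)v)(x)}_{x∈B(y)}
= v(y)exp[iΣ_{x∈B(y)}L^{−d}(1/i) log v⁻¹(y)R(V₀(Γ_{y,x}))v(x)]", read as the definition of the curly-brace average
`{g(x)}_{x∈B(y)} = g(y)exp[Σ_{x∈B(y)}L^{−d} log g(y)⁻¹g(x)]` applied to `g = R(V₀)v = (R_{0,y}v)`. [cite: Balaban1985Averaging, (78) p.30] -/
def SexpZ (L : ℕ) (g : SiteZ d → 𝔸ˣ) (y : SiteZ d) : 𝔸 :=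
  ∑ r : Fin d → Fin L, (((L : ℝ) ^ d)⁻¹) • mlog ((((g y)⁻¹ * g (y + offZ L r) : 𝔸ˣ)) : 𝔸)

-- twin of `B7Eq99Concrete.savg`
/-- (RECORD TWIN: centred blocks, offsets `offZ`, the symmetric (0.4) average `bavgZ`∕`avgIterZ` of `BlockAveragingZd`.) **The site average (78)** `{g(x)}_{x∈B(y)} := g(y)·exp S_g(y)`, a unit of `𝔸`. [cite: Balaban1985Averaging, (78) p.30] -/
def savgZ (L : ℕ) (g : SiteZ d → 𝔸ˣ) (y : SiteZ d) : 𝔸ˣ := g y * expUnit (SexpZ L g y)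

-- twin of `B7Eq99Concrete.R0avg`
/-- (RECORD TWIN: centred blocks, offsets `offZ`, the symmetric (0.4) average `bavgZ`∕`avgIterZ` of `BlockAveragingZd`.) **(78), the twisted site average** `(R̄₀v)(y) := {(R_{0,y}v)(x)}_{x∈B(y)}` of a site function `v` at the background `V₀`.
[cite: Balaban1985Averaging, (78) p.30] -/
def R0avgZ (L : ℕ) (V₀ : SiteZ d → Fin d → 𝔸ˣ) (v : SiteZ d → 𝔸ˣ) (y : SiteZ d) : 𝔸ˣ := savgZ L (R0fun V₀ y v) y

-- twin of `B7Eq92Concrete.tild`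
/-- (RECORD TWIN: centred blocks, offsets `offZ`, the symmetric (0.4) average `bavgZ`∕`avgIterZ` of `BlockAveragingZd`.) **(65)** p. 29: "(Ũ′)_c = (\overline{U′U₀})_c(Ū₀)_c⁻¹" (no domain clause in print) — the one-step average (42) of the product
`V₁V₀` with the averaged background removed, on the `L`-bonds `c = ⟨q, q + Le_κ⟩` (indexed by `(q, κ)` as `bavg`).
[cite: Balaban1985Averaging, (65) p.29, (42) p.23] -/
def tildZ (L : ℕ) (V₀ V₁ : SiteZ d → Fin d → 𝔸ˣ) : SiteZ d → Fin d → 𝔸ˣ :=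
  fun q κ => bavgZ L (V₁ * V₀) q κ * (bavgZ L V₀ q κ)⁻¹

-- twin of `B7Eq92Concrete.tildIter`
/-- (RECORD TWIN: centred blocks, offsets `offZ`, the symmetric (0.4) average `bavgZ`∕`avgIterZ` of `BlockAveragingZd`.) **(69)** p. 29: "Ũ′^j_b = (\overline{U′U₀})^j_b(Ū₀^j)_b⁻¹" — the `j`-fold average (43) of the product with the `j`-fold
averaged background removed, on the bonds of `Ω^{(j)} ≅ ℤ^d`. [cite: Balaban1985Averaging, (69) p.29, (43) p.24] -/
def tildIterZ (L : ℕ) (U₀ U₁ : SiteZ d → Fin d → 𝔸ˣ) (j : ℕ) : SiteZ d → Fin d → 𝔸ˣ :=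
  fun z κ => avgIterZ L (U₁ * U₀) j z κ * (avgIterZ L U₀ j z κ)⁻¹

-- twin of `B7Eq92Concrete.Fcov`
/-- (RECORD TWIN: centred blocks, offsets `offZ`, the symmetric (0.4) average `bavgZ`∕`avgIterZ` of `BlockAveragingZd`.) **The exponent of the block frame (82)/(62) at the background `V₀`**: `F(y) := Σ_{x∈B(y)} L^{−d} log (R_{0,y}V₁)(Γ_{y,x})`
(`y = q`, `x = q + r`, `r ∈ [0, L)^d`, `Γ_{y,x}` the tree contour `treeWord r` from `q`; `log` = the series (21)). Print, (62)
p. 28: "v(y) = exp[−iΣ_{x∈B(y)}L^{−d}(1/i) log(R_{0,y}V₁)(Γ_{y,x})]" (the gauge-fixing transformation, `= F`-frame⁻¹) and (82)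
p. 30: "(R̄₀u)(x₁) = u(x₁)(\overline{R_{0,x₁}U₁})(Γ_{x₁,·}) = u(x₁)\overline{R_{0,x₁}U₁} ... where the expression
\overline{R_{0,x₁}U₁} is defined by the last equation", the bar being the site average (78)
"(R̄₀v)(y) = v(y)exp[iΣ_{x∈B(y)}L^{−d}(1/i) log v⁻¹(y)R(V₀(Γ_{y,x}))v(x)]". At `V₀ = 1` this is `B7Prop3Flat.Favg`
(`Fcov_one_left`). [cite: Balaban1985Averaging, (62) p.28, (78) p.30, (82) p.30, (110) p.34] -/
def FcovZ (L : ℕ) (V₀ V₁ : SiteZ d → Fin d → 𝔸ˣ) (y : SiteZ d) : 𝔸 :=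
  ∑ r : Fin d → Fin L, (((L : ℝ) ^ d)⁻¹) • mlog ((tHol V₀ V₁ y (treeWord (offZ L r)) : 𝔸ˣ) : 𝔸)

-- twin of `B7Eq92Concrete.wframe`
/-- (RECORD TWIN: centred blocks, offsets `offZ`, the symmetric (0.4) average `bavgZ`∕`avgIterZ` of `BlockAveragingZd`.) **The block frame `\overline{R_{0,y}V₁} = exp F(y)`** ((82) p. 30 / (62) p. 28 / (85) p. 31 at `j = 0`), a unit of `𝔸`;
at `V₀ = 1` it is `B7Prop3Flat.vframe` (`wframe_one_left`). [cite: Balaban1985Averaging, (82) p.30, (62) p.28, (85) p.31] -/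
def wframeZ (L : ℕ) (V₀ V₁ : SiteZ d → Fin d → 𝔸ˣ) (y : SiteZ d) : 𝔸ˣ := expUnit (FcovZ L V₀ V₁ y)

-- twin of `B7Eq92Concrete.dbavgCov`
/-- (RECORD TWIN: centred blocks, offsets `offZ`, the symmetric (0.4) average `bavgZ`∕`avgIterZ` of `BlockAveragingZd`.) **(89)** p. 31, the one-step DOUBLE-BAR average at the background `V₀`:
"(\overline{\overline{R(V₀)V₁}})_c = (\overline{R_{0,c₋}V₁})⁻¹(\overline{V₁V₀})_c(V̄₀)_c⁻¹R̄_{0,c}\overline{R_{0,c₊}V₁}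
= (\overline{R_{0,c₋}V₁})⁻¹Ṽ₁R̄_{0,c}\overline{R_{0,c₊}V₁}", `R̄_{0,c} = R((V̄₀)_c)` ((59) p. 27), `c = ⟨q, q + Le_κ⟩`.
At `V₀ = 1` it is `B7Prop3Flat.dbavg` (`dbavgCov_one_left`); it is the instance of the abstract recipe `B7Transfer.dbar`
(`dbar_eq_dbavgCov`). [cite: Balaban1985Averaging, (89) p.31, (59) p.27] -/
def dbavgCovZ (L : ℕ) (V₀ V₁ : SiteZ d → Fin d → 𝔸ˣ) : SiteZ d → Fin d → 𝔸ˣ :=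
  fun q κ => (wframeZ L V₀ V₁ q)⁻¹ * tildZ L V₀ V₁ q κ * Rc (bavgZ L V₀ q κ) (wframeZ L V₀ V₁ (q + (L : ℤ) • e κ))

-- twin of `B7Eq92Concrete.dbavgCovIter`
/-- (RECORD TWIN: centred blocks, offsets `offZ`, the symmetric (0.4) average `bavgZ`∕`avgIterZ` of `BlockAveragingZd`.) **(90)/(91)** p. 31: "U̿₁ = \overline{\overline{R(U₀)U₁}}", "U̿₁^{j+1} = \overline{\overline{R(Ū₀^j)U̿₁^j}}, i.e., it is a
composition of the operation (89) for V₀ = Ū₀^j and of the j-th order operation U̿₁^j" — with `Ū₀^j = avgIterZ L U₀ j` and every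
level read on the unit lattice (`rescale`). At `U₀ = 1`: `B7Prop4Flat.dbavgIter` (`dbavgCovIter_one_left`).
[cite: Balaban1985Averaging, (90)–(91) p.31] -/
def dbavgCovIterZ (L : ℕ) (U₀ U₁ : SiteZ d → Fin d → 𝔸ˣ) : ℕ → SiteZ d → Fin d → 𝔸ˣ
  | 0 => U₁
  | j + 1 => rescale L (dbavgCovZ L (avgIterZ L U₀ j) (dbavgCovIterZ L U₀ U₁ j))

-- twin of `B7Eq92Concrete.vcov`
/-- (RECORD TWIN: centred blocks, offsets `offZ`, the symmetric (0.4) average `bavgZ`∕`avgIterZ` of `BlockAveragingZd`.) **(97)** p. 32, the accumulated frame: "v_j(x) = (\overline{R_{0,x}U₁})(\overline{R̄_{0,x}U̿₁})·…·(\overline{R̄^{j−1}_{0,x}U̿₁^{j−1}})"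
((160) p. 42 is the same product), recursively `v_0 = 1`, `v_{j+1}(z) = v_j(Lz)·\overline{R̄^j_{0,Lz}U̿₁^j}`, the new factor being
the block frame (82) of `U̿₁^j` at the background `Ū₀^j`. At `U₀ = 1`: `B7Prop6Flat.vprod` (`vcov_one_left`).
[cite: Balaban1985Averaging, (97) p.32, (160) p.42] -/
def vcovZ (L : ℕ) (U₀ U₁ : SiteZ d → Fin d → 𝔸ˣ) : ℕ → SiteZ d → 𝔸ˣ
  | 0 => fun _ => 1
  | j + 1 => fun z => vcovZ L U₀ U₁ j ((L : ℤ) • z) * wframeZ L (avgIterZ L U₀ j) (dbavgCovIterZ L U₀ U₁ j) ((L : ℤ) • z)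

-- twin of `B7Eq99Concrete.wrec`
/-- (RECORD TWIN: centred blocks, offsets `offZ`, the symmetric (0.4) average `bavgZ`∕`avgIterZ` of `BlockAveragingZd`.) **(85)** p. 31, the recursively defined block averages `w_j(x) = \overline{R_{0,x}U₁^{(j)}}`, `x ∈ Ω^{(j)} ≅ ℤ^d`:
"\overline{R_{0,x_{j+1}}U₁^{(j+1)}} = {(R̄^j_{0,x_{j+1}}Ũ₁^j)(Γ_{x_{j+1},x_j})(R̄^j_{0,x_{j+1}}\overline{R_{0,x_j}U₁^{(j)}})(x_j)}_{x_j∈B(x_{j+1})},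
x_{j+1} ∈ Ω^{(j+1)}. (85)" — the site average (78), over the block `B(y)` of level-`j` sites (`y = Lz`), of the
`Ū₀^j`-twisted transports of `Ũ₁^j` (69) along `Γ_{y,x}` times the rotated previous averages; then rescaled to `z`. Base:
`w_0 := 1`, so that `w_1 = \overline{R_{0,·}U₁}` is (82) (`wrec_one`). [cite: Balaban1985Averaging, (85) p.31, (82) p.30] -/
def wrecZ (L : ℕ) (U₀ U₁ : SiteZ d → Fin d → 𝔸ˣ) : ℕ → SiteZ d → 𝔸ˣ
  | 0 => fun _ => 1
  | j + 1 => fun z =>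
      savgZ L (fun x => tHol (avgIterZ L U₀ j) (tildIterZ L U₀ U₁ j) ((L : ℤ) • z) (treeWord (x - (L : ℤ) • z))
        * R0fun (avgIterZ L U₀ j) ((L : ℤ) • z) (wrecZ L U₀ U₁ j) x) ((L : ℤ) • z)

-- twin of `B7Eq84Concrete.uavg`
/-- (RECORD TWIN: centred blocks, offsets `offZ`, the symmetric (0.4) average `bavgZ`∕`avgIterZ` of `BlockAveragingZd`.) **(79)/(80)** p. 30, the `k`-th order averaging operation for gauge transformations at the background `U₀`:
"(R̄₀u)(x₁) = (\overline{R(U₀)u})(x₁), x₁ ∈ Ω^{(1)}, (79) (\overline{R₀u}^{j+1})(x_{j+1}) = (\overline{R(Ū₀^j)\overline{R₀u}^j})(x_{j+1}),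
x_{j+1} ∈ Ω^{(j+1)}. (80)" — iterate the twisted site average (78) at the successive averaged backgrounds `Ū₀^j`
(`avgIterZ L U₀ j`), rescaling `Ω^{(j+1)} ≅ ℤ^d` at each step; `\overline{R₀u}^0 := u`.
[cite: Balaban1985Averaging, (79)–(80) p.30, (78) p.30] -/
def uavgZ (L : ℕ) (U₀ : SiteZ d → Fin d → 𝔸ˣ) (u : SiteZ d → 𝔸ˣ) : ℕ → SiteZ d → 𝔸ˣ
  | 0 => u
  | j + 1 => fun z => R0avgZ L (avgIterZ L U₀ j) (uavgZ L U₀ u j) ((L : ℤ) • z)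

-- twin of `B7Eq84Concrete.AxialGauge`
/-- (RECORD TWIN: centred blocks.) The block axial gauge conditions (64)/(66)/(67) p. 29 for `U′ = U₁^u` (moving frame at `U₀`) at the levels `j < k`:
"(R̄^j_{0,y}Ũ′^j)(Γ_{y,x}) = 1, x ∈ B(y), x ≠ y, y ∈ Ω^{(j+1)}, (67)" — `Ũ′^j = tildIterZ L U₀ (mgauge U₀ u U₁) j` (69), the block
`B(y) = y + [0, L)^d` of level-`j` sites around `y = Lz`, `Γ_{y,x} = treeWord (x − y)`; at `x = y` the condition is automatic
(`tHol_nil`), so it is stated for all block points. A PREDICATE (hypothesis of (84), (87), (88) below), not a fact.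
[cite: Balaban1985Averaging, (64) p.29, (66) p.29, (67) p.29] -/
def AxialGaugeZ (L : ℕ) (U₀ U₁ : SiteZ d → Fin d → 𝔸ˣ) (u : SiteZ d → 𝔸ˣ) (k : ℕ) : Prop :=
  ∀ j < k, ∀ (z : SiteZ d) (r : Fin d → Fin L),
    tHol (avgIterZ L U₀ j) (tildIterZ L U₀ (mgauge U₀ u U₁) j) ((L : ℤ) • z) (treeWord (offZ L r)) = 1

-- twin of `B7Eq84Concrete.glev`
/-- (RECORD TWIN: centred blocks, offsets `offZ`, the symmetric (0.4) average `bavgZ`∕`avgIterZ` of `BlockAveragingZd`.) **The level functions of the gauge fixing**, by DOWNWARD recursion from level `k` (print: "Taking (77) for `j = k − 1`,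
we may determine the gauge transformation `u` uniquely, given values `u(y)` at points `y` of the lattice `Ω^{(k)}`", p. 30,
and (87) p. 31 for those values): at level `k`, `u_k := (\overline{R_{0,·}U₁^{(k)}})⁻¹` (87); at a level `j < k`, the solved
axial gauge condition (76) read as a definition, `u_j(x) := R(Ū₀^j(Γ_{y,x}))⁻¹[u_{j+1}(z)·(R̄^j_{0,y}Ũ₁^j)(Γ_{y,x})]` for `x` in the
block of `y = Lz` (`z = fl x`, `x − y = brem x`). `glev … k j` is `u` read at level `j`; the gauge transformation itself is
`glev … k 0`. [cite: Balaban1985Averaging, (76)–(77) p.29–30, (87) p.31] -/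
def glevZ (L : ℕ) (hL : 1 ≤ L) (U₀ U₁ : SiteZ d → Fin d → 𝔸ˣ) (k : ℕ) (j : ℕ) : SiteZ d → 𝔸ˣ :=
  if _h : j < k then fun x =>
    Rc (hol (avgIterZ L U₀ j) ((L : ℤ) • flZ L x) (treeWord (offZ L (bremZ L hL x))))⁻¹
      (glevZ L hL U₀ U₁ k (j + 1) (flZ L x)
        * tHol (avgIterZ L U₀ j) (tildIterZ L U₀ U₁ j) ((L : ℤ) • flZ L x) (treeWord (offZ L (bremZ L hL x))))
  else fun x => (wrecZ L U₀ U₁ k x)⁻¹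
termination_by k - j
decreasing_by omega

-- twin of `B7Eq84Concrete.telHol`
/-- (RECORD TWIN: centred blocks, offsets `offZ`, the symmetric (0.4) average `bavgZ`∕`avgIterZ` of `BlockAveragingZd`.) **`U₀(Γ^{(m)}_{x_m,x})`** — the telescoped parallel transporter from `x` up through the block centres
`x₁, …, x_m`: `U₀(Γ^{(m)}_{x_m,x}) = Ū₀^{m−1}(Γ_{x_m,x_{m−1}})·…·Ū₀(Γ_{x₂,x₁})U₀(Γ_{x₁,x})` (p. 29, the display before (77)),
with `x_i = (flZ L)^[i] x` and `Γ_{x_{i+1},x_i}` the tree contour of the block (`treeWord (boxVec L (brem x_i))` based at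
`L·x_{i+1}` in level-`i` coordinates). [cite: Balaban1985Averaging, p.29 (display before (77)), (77) p.30] -/
def telHolZ (L : ℕ) (hL : 1 ≤ L) (U₀ : SiteZ d → Fin d → 𝔸ˣ) : ℕ → SiteZ d → 𝔸ˣ
  | 0 => fun _ => 1
  | m + 1 => fun x =>
      hol (avgIterZ L U₀ m) ((L : ℤ) • flZ L ((flZ L)^[m] x)) (treeWord (offZ L (bremZ L hL ((flZ L)^[m] x))))
        * telHolZ L hL U₀ m x

-- twin of `B7Eq84Concrete.telTw`
/-- (RECORD TWIN: centred blocks, offsets `offZ`, the symmetric (0.4) average `bavgZ`∕`avgIterZ` of `BlockAveragingZd`.) **`(R_{0,x_m}U₁)(Γ^{(m)}_{x_m,x})`** — the symbol "defined by the last equation" of (77): `T₀ = 1`,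
`T_{m+1}(x) = (R̄^m_{0,x_{m+1}}Ũ^m_1)(Γ_{x_{m+1},x_m}) · R(Ū₀^m(Γ_{x_{m+1},x_m}))[T_m(x)]`, which expands to print's product
`(R̄^m_{0,x_{m+1}}Ũ^m_1)(Γ_{x_{m+1},x_m})·R(Ū^m_0(Γ^{(1)}_{x_{m+1},x_m}))(R̄^{m−1}_{0,x_m}Ũ^{m−1}_1)(Γ_{x_m,x_{m−1}})·…·R(Ū₀(Γ^{(m)}_{x_{m+1},x₁}))(R_{0,x₁}U₁)(Γ_{x₁,x})`
by the multiplicativity (56)/(57) of `R`. [cite: Balaban1985Averaging, (77) p.30] -/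
def telTwZ (L : ℕ) (hL : 1 ≤ L) (U₀ U₁ : SiteZ d → Fin d → 𝔸ˣ) : ℕ → SiteZ d → 𝔸ˣ
  | 0 => fun _ => 1
  | m + 1 => fun x =>
      tHol (avgIterZ L U₀ m) (tildIterZ L U₀ U₁ m) ((L : ℤ) • flZ L ((flZ L)^[m] x))
          (treeWord (offZ L (bremZ L hL ((flZ L)^[m] x))))
        * Rc (hol (avgIterZ L U₀ m) ((L : ℤ) • flZ L ((flZ L)^[m] x)) (treeWord (offZ L (bremZ L hL ((flZ L)^[m] x)))))
            (telTwZ L hL U₀ U₁ m x)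

-- twin of `B7Eq106Concrete.lvHol`
/-- (RECORD TWIN: centred blocks, offsets `offZ`, the symmetric (0.4) average `bavgZ`∕`avgIterZ` of `BlockAveragingZd`.) **`Ū₀^m(Γ_{x_{m+1},x_m})`** — the background transporter of level `m` along the tree contour of the block of `x_m`
(based at `L·x_{m+1}` in level-`m` coordinates); `telHol … (m+1) x = Ū₀^m(Γ_{x_{m+1},x_m})·U₀(Γ^{(m)}_{x_m,x})` (`telHol_succ'`).
[cite: Balaban1985Averaging, p.29 (display before (77)), (103) p.33, (108) p.33] -/
def lvHolZ (L : ℕ) (hL : 1 ≤ L) (U₀ : SiteZ d → Fin d → 𝔸ˣ) (m : ℕ) (x : SiteZ d) : 𝔸ˣ :=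
  hol (avgIterZ L U₀ m) ((L : ℤ) • flZ L ((flZ L)^[m] x)) (treeWord (offZ L (bremZ L hL ((flZ L)^[m] x))))

-- twin of `B7Eq106Concrete.lvTw`
/-- (RECORD TWIN: centred blocks, offsets `offZ`, the symmetric (0.4) average `bavgZ`∕`avgIterZ` of `BlockAveragingZd`.) **`(R̄^m_{0,x_{m+1}}Ũ₁^m)(Γ_{x_{m+1},x_m})`** — the `Ū₀^m`-twisted transport (58) of `Ũ₁^m` (69) along `Γ_{x_{m+1},x_m}`: the
level-`m` factor of (77)/(101). [cite: Balaban1985Averaging, (101)–(102) p.33, (77) p.30] -/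
def lvTwZ (L : ℕ) (hL : 1 ≤ L) (U₀ U₁ : SiteZ d → Fin d → 𝔸ˣ) (m : ℕ) (x : SiteZ d) : 𝔸ˣ :=
  tHol (avgIterZ L U₀ m) (tildIterZ L U₀ U₁ m) ((L : ℤ) • flZ L ((flZ L)^[m] x))
    (treeWord (offZ L (bremZ L hL ((flZ L)^[m] x))))

-- twin of `B7Eq106Concrete.lvDbT`
/-- (RECORD TWIN: centred blocks, offsets `offZ`, the symmetric (0.4) average `bavgZ`∕`avgIterZ` of `BlockAveragingZd`.) **`(R̄^m_{0,x_{m+1}}U̿₁^m)(Γ_{x_{m+1},x_m})`** — the `Ū₀^m`-twisted transport (58) of the double-bar average `U̿₁^m` (91)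
along `Γ_{x_{m+1},x_m}`: the level-`m` factor of (104)/(106)/(107) and the right-hand side of (108).
[cite: Balaban1985Averaging, (102) p.33, (104) p.33, (108) p.33] -/
def lvDbTZ (L : ℕ) (hL : 1 ≤ L) (U₀ U₁ : SiteZ d → Fin d → 𝔸ˣ) (m : ℕ) (x : SiteZ d) : 𝔸ˣ :=
  tHol (avgIterZ L U₀ m) (dbavgCovIterZ L U₀ U₁ m) ((L : ℤ) • flZ L ((flZ L)^[m] x))
    (treeWord (offZ L (bremZ L hL ((flZ L)^[m] x))))

-- twin of `B7Eq106Concrete.lvFr`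
/-- (RECORD TWIN: centred blocks, offsets `offZ`, the symmetric (0.4) average `bavgZ`∕`avgIterZ` of `BlockAveragingZd`.) **`(\overline{R̄^m_{0,x_{m+1}}U̿₁^m})`** (105) — the block frame (82) of `U̿₁^m` at the background `Ū₀^m`, at the centre
`x_{m+1}` (`B7Eq92Concrete.wframe` at `L·x_{m+1}`); by (97) `v_{m+1}(x_{m+1}) = v_m(x_{m+1})·(\overline{R̄^m_{0,x_{m+1}}U̿₁^m})`
(`B7Eq92Concrete.vcov_succ`). [cite: Balaban1985Averaging, (105) p.33, (97) p.32, (82) p.30] -/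
def lvFrZ (L : ℕ) (U₀ U₁ : SiteZ d → Fin d → 𝔸ˣ) (m : ℕ) (x : SiteZ d) : 𝔸ˣ :=
  wframeZ L (avgIterZ L U₀ m) (dbavgCovIterZ L U₀ U₁ m) ((L : ℤ) • flZ L ((flZ L)^[m] x))

-- twin of `B7Eq106Concrete.telUp`
/-- (RECORD TWIN: centred blocks, offsets `offZ`, the symmetric (0.4) average `bavgZ`∕`avgIterZ` of `BlockAveragingZd`.) **`Ū₀^i(Γ^{(n)}_{x_{i+n},x_i})`** — the telescoped transporter of `n` levels STARTING AT LEVEL `i` (p. 29's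
`U₀(Γ^{(j)}_{x_j,x})` for the background `Ū₀^i` and the site `x_i`): `Ū₀^{i+n−1}(Γ_{x_{i+n},x_{i+n−1}})·…·Ū₀^i(Γ_{x_{i+1},x_i})`;
in (101)/(104) `Ū₀^{j+1}(Γ^{(k−j−1)}_{y,x_{j+1}})`, in (103) `Ū₀^j(Γ^{(k−j)}_{y,x_j})`, in (107) `Ū₀^j(Γ^{(l+1−j)}_{x_{l+1},x_j})`. It IS
`telHol` of the level-`i` problem (`B7Eq84Concrete.telHol` at the background `Ū₀^i` and the site `x_i`), by (43) composed.
[cite: Balaban1985Averaging, p.29 (display before (77)), (101) p.33, (103)–(104) p.33, (107) p.33] -/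
def telUpZ (L : ℕ) (hL : 1 ≤ L) (U₀ : SiteZ d → Fin d → 𝔸ˣ) (i n : ℕ) (x : SiteZ d) : 𝔸ˣ :=
  telHolZ L hL (avgIterZ L U₀ i) n ((flZ L)^[i] x)

-- twin of `B7Eq106Concrete.telProd`
/-- (RECORD TWIN: centred blocks, offsets `offZ`, the symmetric (0.4) average `bavgZ`∕`avgIterZ` of `BlockAveragingZd`.) **The common shape of the products (77)/(101) and (104)**: `P₀ = 1`, `P_{m+1} = t_m · R(Ū₀^m(Γ_{x_{m+1},x_m}))[P_m]`, which
generates `∏_{j=m−1}^{0} R(Ū₀^{j+1}(Γ^{(m−j−1)}_{x_m,x_{j+1}})) t_j` (`telProd_eq_dprod`) by the multiplicativity (56)/(57) of `R`; for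
`t_j = (R̄^j_{0,x_{j+1}}Ũ₁^j)(Γ_{x_{j+1},x_j})` it is the symbol `(R_{0,x_m}U₁)(Γ^{(m)}_{x_m,x})` of (77)/(101) (`B7Eq84Concrete.telTw`,
`telTw_eq_telProd`), for `t_j = [(\overline{R̄^j_{0,x_{j+1}}U̿₁^j})⁻¹(R̄^j_{0,x_{j+1}}U̿₁^j)(Γ_{x_{j+1},x_j})]` the right-hand side of (104).
[cite: Balaban1985Averaging, (77) p.30, (101) p.33, (104) p.33] -/
def telProdZ (L : ℕ) (hL : 1 ≤ L) (U₀ : SiteZ d → Fin d → 𝔸ˣ) (x : SiteZ d) (t : ℕ → 𝔸ˣ) : ℕ → 𝔸ˣ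
  | 0 => 1
  | m + 1 => t m * Rc (lvHolZ L hL U₀ m x) (telProdZ L hL U₀ x t m)

end Twins

/-! ## §6 Recursion equations and base cases (definitional) -/

section Eqns

variable {𝔸 : Type*} [NormedRing 𝔸] [NormedAlgebra ℂ 𝔸] [CompleteSpace 𝔸] (L : ℕ)

/-- `\overline{R₀u}^0 = u`. [cite: Balaban1985Averaging, (79) p.30] -/
@[simp] theorem uavgZ_zero (U₀ : SiteZ d → Fin d → 𝔸ˣ) (u : SiteZ d → 𝔸ˣ) : uavgZ L U₀ u 0 = u := rfl

/-- `\overline{R₀u}^{j+1}(z) = (R̄₀ \overline{R₀u}^{j})(Lz)` at the background `Ū₀^j` (80). [cite: Balaban1985Averaging, (80) p.30] -/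
theorem uavgZ_succ (U₀ : SiteZ d → Fin d → 𝔸ˣ) (u : SiteZ d → 𝔸ˣ) (j : ℕ) (z : SiteZ d) :
    uavgZ L U₀ u (j + 1) z = R0avgZ L (avgIterZ L U₀ j) (uavgZ L U₀ u j) ((L : ℤ) • z) := rfl

/-- `Ũ′^j = \overline{U′U₀}^j (Ū₀^j)⁻¹` pointwise (69). [cite: Balaban1985Averaging, (69) p.29] -/
theorem tildIterZ_apply (U₀ U₁ : SiteZ d → Fin d → 𝔸ˣ) (j : ℕ) (z : SiteZ d) (κ : Fin d) :
    tildIterZ L U₀ U₁ j z κ = avgIterZ L (U₁ * U₀) j z κ * (avgIterZ L U₀ j z κ)⁻¹ := rfl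

/-- `U̿₁^0 = U₁` (90). [cite: Balaban1985Averaging, (90) p.31] -/
@[simp] theorem dbavgCovIterZ_zero (U₀ U₁ : SiteZ d → Fin d → 𝔸ˣ) : dbavgCovIterZ L U₀ U₁ 0 = U₁ := rfl

/-- `U̿₁^{j+1} = rescale L (\overline{\overline{R(Ū₀^j)U̿₁^j}})` (91). [cite: Balaban1985Averaging, (91) p.31] -/
theorem dbavgCovIterZ_succ (U₀ U₁ : SiteZ d → Fin d → 𝔸ˣ) (j : ℕ) :
    dbavgCovIterZ L U₀ U₁ (j + 1) = rescale L (dbavgCovZ L (avgIterZ L U₀ j) (dbavgCovIterZ L U₀ U₁ j)) := rfl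

/-- `v_0 = 1` (97). [cite: Balaban1985Averaging, (97) p.32] -/
@[simp] theorem vcovZ_zero (U₀ U₁ : SiteZ d → Fin d → 𝔸ˣ) (z : SiteZ d) : vcovZ L U₀ U₁ 0 z = 1 := rfl

/-- `v_{j+1}(z) = v_j(Lz)·\overline{R̄^j_{0,Lz}U̿₁^j}` (97). [cite: Balaban1985Averaging, (97) p.32] -/
theorem vcovZ_succ (U₀ U₁ : SiteZ d → Fin d → 𝔸ˣ) (j : ℕ) (z : SiteZ d) :
    vcovZ L U₀ U₁ (j + 1) z = vcovZ L U₀ U₁ j ((L : ℤ) • z) * wframeZ L (avgIterZ L U₀ j) (dbavgCovIterZ L U₀ U₁ j) ((L : ℤ) • z) := rfl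

/-- `w_0 = 1` (85). [cite: Balaban1985Averaging, (85) p.31] -/
@[simp] theorem wrecZ_zero (U₀ U₁ : SiteZ d → Fin d → 𝔸ˣ) (z : SiteZ d) : wrecZ L U₀ U₁ 0 z = 1 := rfl

/-- `U₀(Γ^{(0)}) = 1` (77). [cite: Balaban1985Averaging, (77) p.30] -/
@[simp] theorem telHolZ_zero (hL : 1 ≤ L) (U₀ : SiteZ d → Fin d → 𝔸ˣ) (x : SiteZ d) : telHolZ L hL U₀ 0 x = 1 := rfl

/-- `T₀ = 1` (77). [cite: Balaban1985Averaging, (77) p.30] -/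
@[simp] theorem telTwZ_zero (hL : 1 ≤ L) (U₀ U₁ : SiteZ d → Fin d → 𝔸ˣ) (x : SiteZ d) : telTwZ L hL U₀ U₁ 0 x = 1 := rfl

/-- `P₀ = 1` (77)∕(101). [cite: Balaban1985Averaging, (77) p.30, (101) p.33] -/
@[simp] theorem telProdZ_zero (hL : 1 ≤ L) (U₀ : SiteZ d → Fin d → 𝔸ˣ) (x : SiteZ d) (t : ℕ → 𝔸ˣ) : telProdZ L hL U₀ x t 0 = 1 := rfl

end Eqns

end Literature.MathematicalPhysics.QuantumFieldTheory.Balaban1983to89.B7SectCDGaugeAveragesRec
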